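import Literature.NumberTheory.GaloisRepresentations.ContinuousCohomologyIntCoefficients
import Literature.AnabelianGeometry.AbsoluteAnabelian.ZHatCompletionFreeProcyclic
import HarnessLib

/-!
# `H²(Ẑ, ℤ) ≅ ℚ/ℤ` for the cell's two `Ẑ`'s: free procyclic groups (`IsFreeProcyclic`) and
# Mathlib's profinite completion of `ℤ`

abc-iut cell, layer L4.  ADAPTER (no new statement of record, no named fact) between the trunk's
continuous Bockstein files (`ContinuousCohomologyBockstein.lean`: `IsSES.δ₁Equiv`,
`IsSES.H2EquivOfDenseZpowers`; `ContinuousCohomologyIntCoefficients.lean`: the discrete coefficient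
modules `ZCoeff ⊆ QCoeff ↠ QModZCoeff` and `H2IntEquivQModZ : H²(G, ℤ) ≃ₗ[ℤ] ℚ/ℤ` for a profinite `G`
with a dense cyclic subgroup and an open subgroup of every positive index) and the two incarnations
of "`Ẑ` = the profinite completion of `ℤ`" used by the L4 vocabulary:

* `FundamentalExtension.IsFreeProcyclic.H2IntEquivQModZ` — for `G` profinite with
  `IsFreeProcyclic G` ([AbsTopIII] Prop. 1.4 (i) "`I_x` … is naturally isomorphic to `Ẑ(1)`"; the
  intrinsic predicate of `FundamentalExtension.lean`) and ANY topological generator `γ`: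
  `H²(G, ℤ) ≃ₗ[ℤ] ℚ/ℤ`, `[c] ↦ (δ⁻¹[c])(γ)`;
* `ZHatCompletion.H2IntEquivQModZ` — for Mathlib's `Ẑ = completion (GrpCat.of (Multiplicative ℤ))`
  with its canonical generator `η(1)` (the target of abc-iut-L4-t1's Frobenius character
  `NFPortionAlgorithm.frobQuot : G_k → Ẑ` of [AbsTopIII] Cor. 1.10 (i)(b) "`G_k^ab ↠ G^unr ⥲ Ẑ`
  determined by the Frobenius element", `Reconstruction.lean`): `H²(Ẑ, ℤ) ≃ₗ[ℤ] ℚ/ℤ`,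
  `[c] ↦ (δ⁻¹[c])(η(1))` — the isomorphism "`H²(Ẑ, ℤ) ⥲ ℚ/ℤ`" of [AbsTopIII] Prop. 3.2 (i) p. 71
  l. 45–47 (sub-DAG row P32.i.L05, field `Prop32iChain.toQmodZ` of `MonoidKummerMapsSub.lean`, with
  `H2ZhatZ := H²(Ẑ, ZCoeff)`; compose with `QModZCoeff.equivULift` to land in the cell's `QmodZ`),
  equivalently the last arrow of the residue map of [AbsAnab] Prop. 1.2.1 (vii) (sub-DAG row L05′).

Both come with the characterisation of the inverse: the class with invariant `x` is the Bockstein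
`δ [φ]` of the unique continuous character `φ` with `φ(γ) = x`.  Textbook material (Serre, *Local
Fields* XIII §3); HONEST FRAMING: nothing here bears on [IUTchIII] Cor. 3.12 or takes a side.
-/

noncomputable section

open CategoryTheory ProfiniteGrp ProfiniteGrp.ProfiniteCompletion Topology

universe u

namespace Literature.AnabelianGeometry.AbsoluteAnabelian

open Literature.NumberTheory.GaloisRepresentations

/-! ### Free procyclic groups -/

section FreeProcyclic

variable {G : Type u} [Group G] [TopologicalSpace G] [IsTopologicalGroup G] [CompactSpace G]
  [T2Space G] [TotallyDisconnectedSpace G]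

/-- **`H²(G, ℤ) ≅ ℚ/ℤ` for a free procyclic profinite group `G` and a topological generator `γ`**
("`I_x ≅ Ẑ(1)`"-type groups; `[c] ↦ (δ⁻¹[c])(γ)`): the trunk's `H2IntEquivQModZ` fed with the two
fields of `IsFreeProcyclic`. [cite: MochizukiAbsTopIII2015, Prop 1.4 (i) p.31] -/
def FundamentalExtension.IsFreeProcyclic.H2IntEquivQModZ (h : FundamentalExtension.IsFreeProcyclic G)
    {γ : G} (hγ : Dense (Subgroup.zpowers γ : Set G)) :
    continuousCohomology 2 (ContinuousRep.trivial G ℤ ZCoeff.{u}).toTopRep ≃ₗ[ℤ] QModZCoeff.{u} :=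
  Literature.NumberTheory.GaloisRepresentations.H2IntEquivQModZ hγ h.exists_isOpen_index

/-- The inverse: `(H2IntEquivQModZ h hγ)⁻¹ x = δ [φ]` for every continuous character `φ : G → ℚ/ℤ`
with `φ(γ) = x`. [cite: MochizukiAbsTopIII2015, Prop 1.4 (i) p.31] -/
theorem FundamentalExtension.IsFreeProcyclic.H2IntEquivQModZ_symm_apply_eq
    (h : FundamentalExtension.IsFreeProcyclic G) {γ : G} (hγ : Dense (Subgroup.zpowers γ : Set G))
    (x : QModZCoeff.{u})
    (φ : contOneCocycles (ContinuousRep.trivial G ℤ QModZCoeff.{u}).toTopRep) (hφ : φ.1 γ = x) :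
    (h.H2IntEquivQModZ hγ).symm x = (isSES_ZQ G).δ₁ (oneCocycleClass _ φ) :=
  Literature.NumberTheory.GaloisRepresentations.H2IntEquivQModZ_symm_apply_eq hγ h.exists_isOpen_index
    x φ hφ

/-- Generator-free existence form: a free procyclic profinite group has `H²(G, ℤ) ≅ ℚ/ℤ`.
[cite: MochizukiAbsTopIII2015, Prop 1.4 (i) p.31] -/
theorem FundamentalExtension.IsFreeProcyclic.nonempty_H2Int_linearEquiv_QModZ
    (h : FundamentalExtension.IsFreeProcyclic G) :
    Nonempty (continuousCohomology 2 (ContinuousRep.trivial G ℤ ZCoeff.{u}).toTopRep ≃ₗ[ℤ]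
      QModZCoeff.{u}) := by
  obtain ⟨γ, hγ⟩ := h.exists_dense_zpowers
  exact ⟨h.H2IntEquivQModZ hγ⟩

end FreeProcyclic

/-! ### Mathlib's profinite completion `Ẑ` of `ℤ` -/

/-- **`H²(Ẑ, ℤ) ⥲ ℚ/ℤ`** for Mathlib's profinite completion `Ẑ` of `ℤ` and its generator `η(1)`,
`[c] ↦ (δ⁻¹[c])(η(1))` — the printed "`H²(Ẑ, ℤ) ⥲ ℚ/ℤ`" of [AbsTopIII] Prop. 3.2 (i) (row P32.i.L05;
`Ẑ` = the target of the Frobenius character `frobQuot` of Cor. 1.10 (i)(b)).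
[cite: MochizukiAbsTopIII2015, Proposition 3.2 (i) p.71] -/
def ZHatCompletion.H2IntEquivQModZ :
    continuousCohomology 2
        (ContinuousRep.trivial (completion (GrpCat.of (Multiplicative ℤ))) ℤ ZCoeff.{0}).toTopRep ≃ₗ[ℤ]
      QModZCoeff.{0} :=
  Literature.NumberTheory.GaloisRepresentations.H2IntEquivQModZ ZHatCompletion.dense_zpowers_eta_one
    fun _ hn => ZHatCompletion.exists_isOpen_index hn

/-- The inverse: `(ZHatCompletion.H2IntEquivQModZ)⁻¹ x = δ [φ]` for every continuous character
`φ : Ẑ → ℚ/ℤ` with `φ(η(1)) = x` — "the class of `H²(Ẑ, ℤ)` with invariant `x` is the Bockstein of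
the character `F ↦ x`". [cite: MochizukiAbsTopIII2015, Proposition 3.2 (i) p.71] -/
theorem ZHatCompletion.H2IntEquivQModZ_symm_apply_eq (x : QModZCoeff.{0})
    (φ : contOneCocycles
      (ContinuousRep.trivial (completion (GrpCat.of (Multiplicative ℤ))) ℤ QModZCoeff.{0}).toTopRep)
    (hφ : φ.1 (etaFn (GrpCat.of (Multiplicative ℤ)) (Multiplicative.ofAdd (1 : ℤ) : Multiplicative ℤ)) = x) :
    ZHatCompletion.H2IntEquivQModZ.symm x =
      (isSES_ZQ (completion (GrpCat.of (Multiplicative ℤ)))).δ₁ (oneCocycleClass _ φ) :=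
  Literature.NumberTheory.GaloisRepresentations.H2IntEquivQModZ_symm_apply_eq
    ZHatCompletion.dense_zpowers_eta_one (fun _ hn => ZHatCompletion.exists_isOpen_index hn) x φ hφ

/-- `H²(Ẑ, ℤ) ≅ ℚ/ℤ` as additive groups with values in the cell's `QmodZ = ULift (AddCircle (1 : ℚ))`
(the shape of the field `Prop32iChain.toQmodZ`, at universe `0`).
[cite: MochizukiAbsTopIII2015, Proposition 3.2 (i) p.71] -/
def ZHatCompletion.H2IntAddEquivULiftAddCircle :
    continuousCohomology 2
        (ContinuousRep.trivial (completion (GrpCat.of (Multiplicative ℤ))) ℤ ZCoeff.{0}).toTopRep ≃+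
      ULift.{0} (AddCircle (1 : ℚ)) :=
  ZHatCompletion.H2IntEquivQModZ.toAddEquiv.trans QModZCoeff.equivULift

end Literature.AnabelianGeometry.AbsoluteAnabelian

end
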